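import Summits.BirchSwinnertonDyer.BirchSwinnertonDyer.Theorems.Rank2ObservatoryRank3PSatCertK
import Summits.BirchSwinnertonDyer.BirchSwinnertonDyer.Theorems.Rank2ObservatoryRank3Rows08
import Summits.BirchSwinnertonDyer.BirchSwinnertonDyer.Theorems.Rank2ObservatoryRank3Rows09
import Summits.BirchSwinnertonDyer.BirchSwinnertonDyer.Theorems.Rank2ObservatoryRank3Rows10
import Summits.BirchSwinnertonDyer.BirchSwinnertonDyer.Theorems.Rank2ObservatoryRank3Rows11
import Summits.BirchSwinnertonDyer.BirchSwinnertonDyer.Theorems.Rank2ObservatoryRank3Rows12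
import Summits.BirchSwinnertonDyer.BirchSwinnertonDyer.Theorems.Rank2ObservatoryRank3Rows13
import Summits.BirchSwinnertonDyer.BirchSwinnertonDyer.Theorems.Rank2ObservatoryRank3PSat357Census
import Summits.BirchSwinnertonDyer.BirchSwinnertonDyer.Theorems.Rank2ObservatoryRank3PSatM31JoinA
import HarnessLib

/-!
# BirchSwinnertonDyer — rank ≥ 2 observatory: S10-CPS census (J11c), chunks 08–13: GENERATORS

HONEST FRAMING: per-curve certified theorems and census instruments; no claim on BSD in rank ≥ 2.

THE CPS-BOUND SEARCH CENSUS, chunks 08–13 (77 rows of these chunks; 396 of the 9 487 GRAND rank-3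
rows in all — rows of the residual 396 of the generators union census
`GeneratorsCensus.census_total`, i.e. rows whose Silverman-constant search bound exceeded every
earlier register). Register J11c replaces Silverman's height-difference constant by the
Cremona–Prickett–Siksek bound [CremonaPrickettSiksek2006, Thm 1 with Table 1 and Lemmas 9–10: on the
global minimal model, `h(P) − ĥ(P) ≤ (1/3) log ε_∞ + Σ_p α_p log p`, `h(P) = log max(|num x|, den
x)`, `ĥ` in the PARI / BSD normalisation `lim h(2ⁿP)/4ⁿ`] computed by TWO implementations that AGREE
on every listed row (identical (p, Kodaira symbol, c_p) at every bad prime and |B_A − B_B| ≤ 10⁻⁶;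
the register uses max(B_A, B_B) + 0.01): implementation A = PARI `elllocalred` + `polrootsreal`
(kit), cell implementation B = exact rational Sturm arithmetic for the real place + a PARI-free Tate
algorithm (validated against the paper's Examples 3–4 to 10⁻⁹). Both implementations then enumerate
ALL points of naive height `max(|num x|, den x) ≤ H` (A: PARI `ellratpoints` + `ellorder` +
`ellheight`; B: the engine of record `ecpointsieve` 0.1.0, engines MANIFEST 0c2f6b8785a885b8, exact
torsion and exact-doubling height brackets) and AGREE (point count, non-torsion count, A's minimal
height inside B's bracket, the listed generators found). The datum `m` is: LEVER H — Hermite (`γ₃³ =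
2`) with `λ₁ ≥ min(log(H+1) − B, min ĥ found)`, `index ≤ m = ⌊√(2·Reg_hi/λ₁³)⌋ ≤ 10`, the larger of
the two implementations' values; LEVER S (rows whose `λ₁` is fixed by an actual small point,
recorded with `m = 1`) — saturation by exhaustive search [Siksek, Rocky Mountain J. Math. 25 (1995);
CremonaAlgorithms1997 §3.5]: with `Λ* = ¼·max_± ĥ(P₁ ± P₂ ± P₃)` and `log(H+1) > Λ* + B`, every
point of `E(ℚ)` with `ĥ ≤ Λ*` is enumerated, and BOTH implementations decide EXACTLY (integer
coefficients, exact group law, exact torsion test) that each of them lies in `ℤP₁ + ℤP₂ + ℤP₃ +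
E(ℚ)_tors`; since a proper finite-index sublattice of full rank leaves a coset representative of
height `≤ Λ*` outside, the index is 1 (the rank `= 3` of the row is the recorded rank,
kernel-certified for the rows of `Rank3KernelRankCensusN9375`). As in the landed S10 files the
number `m` is instrument DATA: it enters ONLY as the hypothesis `index ≤ m` of `generatorsNN` and as
the (EMPTY: no prime `7 < p ≤ m ≤ 10`) range of the saturation certificate list, checked by the
landed selection Boolean `rank3PSatCheckKSel` by kernel `decide` (`pSatCheckK_NN`), exported by the
landed soundness theorem `Rank3Row.pSaturated_of_pSatCheckKSel_idx` (`coverNN`), and JOINED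
(`generatorsNN`) with the KS3 census `PSatCensus357.index_coprime_210_of_mem_rows` exactly as in
`PSatCensusS10`: under the ONE named numeric hypothesis `index ≤ m` the listed points and the
torsion GENERATE. No definitions; no new lemmas. Register (instrument data, kit job j342025, tag
bsd-r1): cell `code/b2b-bsdr2-cert-2/sat2-r3/g46/j11c/prod-j342025/` — `register-J11c.tsv` sha256
d829e0e83d7ddbf6…, `j11c.jsonl` sha256 82254102cac8b632…, SHA256SUMS, README-J11c.md (method, the
LEVER S argument, referee spot-check kit).

References: Cremona–Prickett–Siksek, J. Number Theory 116 (2006) 42–68, Thm 1, Table 1, Lemmas 9–10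
[CremonaPrickettSiksek2006]; Siksek, Rocky Mountain J. Math. 25 (1995) 1501–1538, §3; Cremona,
*Algorithms for Modular Elliptic Curves* (1997) §3.5 [CremonaAlgorithms1997]; Silverman,
*The Arithmetic of Elliptic Curves* (2009) VIII.6.7.
-/

-- single-conjunct summit: `Summit.BirchSwinnertonDyer.BirchSwinnertonDyer.…` repeats the name
set_option linter.dupNamespace false

namespace Summit.BirchSwinnertonDyer.BirchSwinnertonDyer.Rank2Observatory

namespace PSatCensusS10CPS

open Rank3KernelRankCensusN9365 (rows mem_rank3Table rank_eq_three)
open PSatCensusM31 (eq_one_of_forall_prime_le_not_dvd not_dvd_of_prime_le_seven)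

/-- **Chunk 08, register J11c** (12 rows, two-implementation CPS-bound datum `m ≤ 10`): kernel check
of the selection `(position, m, [])` — every listed row exists in `rank3Rows08` and no prime
`7 < p ≤ m` is left uncertified (there is none). [cite: CremonaPrickettSiksek2006, Thm 1] -/
theorem pSatCheckK_08 :
    rank3PSatCheckKSel rank3Rows08 [
    (82, 1, []), (83, 3, []), (116, 1, []), (141, 3, []), (195, 1, []), (234, 1, []), (248, 3, []),
    (267, 2, []), (275, 2, []), (295, 1, []), (302, 3, []), (317, 1, [])] = true := by
  decide +kernel

set_option maxRecDepth 8000 in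
/-- **Chunk 08: cover** — for every listed `(i, m)` the row `rank3Rows08[i]` exists and its listed
span is `p`-saturated for every prime `7 < p ≤ m` (vacuous range; generic soundness of the selection
form). [cite: CremonaAlgorithms1997, §3.5] -/
theorem cover08 :
    ∀ e ∈ ([
      (82, 1), (83, 3), (116, 1), (141, 3), (195, 1), (234, 1), (248, 3), (267, 2), (275, 2),
      (295, 1), (302, 3), (317, 1)] : List (ℕ × ℕ)),
      ∃ r, rank3Rows08[e.1]? = some r ∧ ∀ p, p.Prime → 7 < p → p ≤ e.2 →
        ∀ h : r.check = true, ∀ a : r.curve.toAffine.Point,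
          p • a ∈ AddSubgroup.closure {r.gen₁ h, r.gen₂ h, r.gen₃ h} ⊔ AddCommGroup.torsion _ →
            a ∈ AddSubgroup.closure {r.gen₁ h, r.gen₂ h, r.gen₃ h} ⊔ AddCommGroup.torsion _ :=
  Rank3Row.pSaturated_of_pSatCheckKSel_idx (by rfl) pSatCheckK_08

/-- **GENERATORS under ONE named numeric hypothesis, chunk 08** (12 rows, register J11c
`m ≤ 10`; `m = 1` rows = LEVER S, saturation by exhaustive search): for every listed `(i, m)`, if
`rank3Rows08[i]` is a GRAND row and the index of its listed span is `≤ m` (instrument DATA, two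
implementations agree), then `E(ℚ) = ℤP₁ + ℤP₂ + ℤP₃ + E(ℚ)_tors`.
[cite: CremonaPrickettSiksek2006, Thm 1] [cite: CremonaAlgorithms1997, §3.5] -/
theorem generators08 :
    ∀ e ∈ ([
      (82, 1), (83, 3), (116, 1), (141, 3), (195, 1), (234, 1), (248, 3), (267, 2), (275, 2),
      (295, 1), (302, 3), (317, 1)] : List (ℕ × ℕ)),
      ∃ r, rank3Rows08[e.1]? = some r ∧ ∀ (hr : r ∈ rows) (h : r.check = true),
        (AddSubgroup.closure {r.gen₁ h, r.gen₂ h, r.gen₃ h} ⊔ AddCommGroup.torsion _).index ≤ e.2 →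
          AddSubgroup.closure {r.gen₁ h, r.gen₂ h, r.gen₃ h} ⊔ AddCommGroup.torsion _ = ⊤ := by
  intro e he
  obtain ⟨r, hr', H⟩ := cover08 e he
  refine ⟨r, hr', fun hr h hB => ?_⟩
  obtain ⟨hfi, h2, h3, h5, h7⟩ := PSatCensus357.index_coprime_210_of_mem_rows hr h
  haveI := hfi
  refine AddSubgroup.index_eq_one.mp
    (eq_one_of_forall_prime_le_not_dvd AddSubgroup.FiniteIndex.index_ne_zero hB fun p hp hpB => ?_)
  by_cases h7p : 7 < p
  · exact not_dvd_index_listedSpan hp (H p hp h7p hpB h)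
  · exact not_dvd_of_prime_le_seven h2 h3 h5 h7 hp h7p

/-- **Chunk 09, register J11c** (8 rows, two-implementation CPS-bound datum `m ≤ 10`): kernel check
of the selection `(position, m, [])` — every listed row exists in `rank3Rows09` and no prime
`7 < p ≤ m` is left uncertified (there is none). [cite: CremonaPrickettSiksek2006, Thm 1] -/
theorem pSatCheckK_09 :
    rank3PSatCheckKSel rank3Rows09 [
    (101, 3, []), (188, 1, []), (207, 1, []), (208, 1, []), (229, 2, []), (230, 6, []),
    (244, 1, []), (268, 2, [])] = true := by
  decide +kernel

set_option maxRecDepth 8000 in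
/-- **Chunk 09: cover** — for every listed `(i, m)` the row `rank3Rows09[i]` exists and its listed
span is `p`-saturated for every prime `7 < p ≤ m` (vacuous range; generic soundness of the selection
form). [cite: CremonaAlgorithms1997, §3.5] -/
theorem cover09 :
    ∀ e ∈ ([
      (101, 3), (188, 1), (207, 1), (208, 1), (229, 2), (230, 6), (244, 1), (268,
      2)] : List (ℕ × ℕ)),
      ∃ r, rank3Rows09[e.1]? = some r ∧ ∀ p, p.Prime → 7 < p → p ≤ e.2 →
        ∀ h : r.check = true, ∀ a : r.curve.toAffine.Point,
          p • a ∈ AddSubgroup.closure {r.gen₁ h, r.gen₂ h, r.gen₃ h} ⊔ AddCommGroup.torsion _ →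
            a ∈ AddSubgroup.closure {r.gen₁ h, r.gen₂ h, r.gen₃ h} ⊔ AddCommGroup.torsion _ :=
  Rank3Row.pSaturated_of_pSatCheckKSel_idx (by rfl) pSatCheckK_09

/-- **GENERATORS under ONE named numeric hypothesis, chunk 09** (8 rows, register J11c
`m ≤ 10`; `m = 1` rows = LEVER S, saturation by exhaustive search): for every listed `(i, m)`, if
`rank3Rows09[i]` is a GRAND row and the index of its listed span is `≤ m` (instrument DATA, two
implementations agree), then `E(ℚ) = ℤP₁ + ℤP₂ + ℤP₃ + E(ℚ)_tors`.
[cite: CremonaPrickettSiksek2006, Thm 1] [cite: CremonaAlgorithms1997, §3.5] -/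
theorem generators09 :
    ∀ e ∈ ([
      (101, 3), (188, 1), (207, 1), (208, 1), (229, 2), (230, 6), (244, 1), (268,
      2)] : List (ℕ × ℕ)),
      ∃ r, rank3Rows09[e.1]? = some r ∧ ∀ (hr : r ∈ rows) (h : r.check = true),
        (AddSubgroup.closure {r.gen₁ h, r.gen₂ h, r.gen₃ h} ⊔ AddCommGroup.torsion _).index ≤ e.2 →
          AddSubgroup.closure {r.gen₁ h, r.gen₂ h, r.gen₃ h} ⊔ AddCommGroup.torsion _ = ⊤ := by
  intro e he
  obtain ⟨r, hr', H⟩ := cover09 e he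
  refine ⟨r, hr', fun hr h hB => ?_⟩
  obtain ⟨hfi, h2, h3, h5, h7⟩ := PSatCensus357.index_coprime_210_of_mem_rows hr h
  haveI := hfi
  refine AddSubgroup.index_eq_one.mp
    (eq_one_of_forall_prime_le_not_dvd AddSubgroup.FiniteIndex.index_ne_zero hB fun p hp hpB => ?_)
  by_cases h7p : 7 < p
  · exact not_dvd_index_listedSpan hp (H p hp h7p hpB h)
  · exact not_dvd_of_prime_le_seven h2 h3 h5 h7 hp h7p

/-- **Chunk 10, register J11c** (12 rows, two-implementation CPS-bound datum `m ≤ 10`): kernel check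
of the selection `(position, m, [])` — every listed row exists in `rank3Rows10` and no prime
`7 < p ≤ m` is left uncertified (there is none). [cite: CremonaPrickettSiksek2006, Thm 1] -/
theorem pSatCheckK_10 :
    rank3PSatCheckKSel rank3Rows10 [
    (10, 2, []), (79, 1, []), (114, 4, []), (143, 1, []), (204, 1, []), (254, 3, []), (262, 3, []),
    (274, 5, []), (313, 1, []), (319, 6, []), (320, 2, []), (349, 1, [])] = true := by
  decide +kernel

set_option maxRecDepth 8000 in
/-- **Chunk 10: cover** — for every listed `(i, m)` the row `rank3Rows10[i]` exists and its listed
span is `p`-saturated for every prime `7 < p ≤ m` (vacuous range; generic soundness of the selection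
form). [cite: CremonaAlgorithms1997, §3.5] -/
theorem cover10 :
    ∀ e ∈ ([
      (10, 2), (79, 1), (114, 4), (143, 1), (204, 1), (254, 3), (262, 3), (274, 5), (313, 1),
      (319, 6), (320, 2), (349, 1)] : List (ℕ × ℕ)),
      ∃ r, rank3Rows10[e.1]? = some r ∧ ∀ p, p.Prime → 7 < p → p ≤ e.2 →
        ∀ h : r.check = true, ∀ a : r.curve.toAffine.Point,
          p • a ∈ AddSubgroup.closure {r.gen₁ h, r.gen₂ h, r.gen₃ h} ⊔ AddCommGroup.torsion _ →
            a ∈ AddSubgroup.closure {r.gen₁ h, r.gen₂ h, r.gen₃ h} ⊔ AddCommGroup.torsion _ :=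
  Rank3Row.pSaturated_of_pSatCheckKSel_idx (by rfl) pSatCheckK_10

/-- **GENERATORS under ONE named numeric hypothesis, chunk 10** (12 rows, register J11c
`m ≤ 10`; `m = 1` rows = LEVER S, saturation by exhaustive search): for every listed `(i, m)`, if
`rank3Rows10[i]` is a GRAND row and the index of its listed span is `≤ m` (instrument DATA, two
implementations agree), then `E(ℚ) = ℤP₁ + ℤP₂ + ℤP₃ + E(ℚ)_tors`.
[cite: CremonaPrickettSiksek2006, Thm 1] [cite: CremonaAlgorithms1997, §3.5] -/
theorem generators10 :
    ∀ e ∈ ([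
      (10, 2), (79, 1), (114, 4), (143, 1), (204, 1), (254, 3), (262, 3), (274, 5), (313, 1),
      (319, 6), (320, 2), (349, 1)] : List (ℕ × ℕ)),
      ∃ r, rank3Rows10[e.1]? = some r ∧ ∀ (hr : r ∈ rows) (h : r.check = true),
        (AddSubgroup.closure {r.gen₁ h, r.gen₂ h, r.gen₃ h} ⊔ AddCommGroup.torsion _).index ≤ e.2 →
          AddSubgroup.closure {r.gen₁ h, r.gen₂ h, r.gen₃ h} ⊔ AddCommGroup.torsion _ = ⊤ := by
  intro e he
  obtain ⟨r, hr', H⟩ := cover10 e he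
  refine ⟨r, hr', fun hr h hB => ?_⟩
  obtain ⟨hfi, h2, h3, h5, h7⟩ := PSatCensus357.index_coprime_210_of_mem_rows hr h
  haveI := hfi
  refine AddSubgroup.index_eq_one.mp
    (eq_one_of_forall_prime_le_not_dvd AddSubgroup.FiniteIndex.index_ne_zero hB fun p hp hpB => ?_)
  by_cases h7p : 7 < p
  · exact not_dvd_index_listedSpan hp (H p hp h7p hpB h)
  · exact not_dvd_of_prime_le_seven h2 h3 h5 h7 hp h7p

/-- **Chunk 11, register J11c** (20 rows, two-implementation CPS-bound datum `m ≤ 10`): kernel check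
of the selection `(position, m, [])` — every listed row exists in `rank3Rows11` and no prime
`7 < p ≤ m` is left uncertified (there is none). [cite: CremonaPrickettSiksek2006, Thm 1] -/
theorem pSatCheckK_11 :
    rank3PSatCheckKSel rank3Rows11 [
    (6, 3, []), (7, 7, []), (51, 1, []), (89, 1, []), (106, 1, []), (119, 1, []), (122, 1, []),
    (141, 10, []), (142, 1, []), (163, 1, []), (177, 3, []), (207, 1, []), (214, 2, []),
    (237, 1, []), (264, 4, []), (265, 2, []), (281, 1, []), (328, 1, []), (338, 5, []),
    (349, 1, [])] = true := by
  decide +kernel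

set_option maxRecDepth 8000 in
/-- **Chunk 11: cover** — for every listed `(i, m)` the row `rank3Rows11[i]` exists and its listed
span is `p`-saturated for every prime `7 < p ≤ m` (vacuous range; generic soundness of the selection
form). [cite: CremonaAlgorithms1997, §3.5] -/
theorem cover11 :
    ∀ e ∈ ([
      (6, 3), (7, 7), (51, 1), (89, 1), (106, 1), (119, 1), (122, 1), (141, 10), (142, 1), (163, 1),
      (177, 3), (207, 1), (214, 2), (237, 1), (264, 4), (265, 2), (281, 1), (328, 1), (338, 5),
      (349, 1)] : List (ℕ × ℕ)),
      ∃ r, rank3Rows11[e.1]? = some r ∧ ∀ p, p.Prime → 7 < p → p ≤ e.2 →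
        ∀ h : r.check = true, ∀ a : r.curve.toAffine.Point,
          p • a ∈ AddSubgroup.closure {r.gen₁ h, r.gen₂ h, r.gen₃ h} ⊔ AddCommGroup.torsion _ →
            a ∈ AddSubgroup.closure {r.gen₁ h, r.gen₂ h, r.gen₃ h} ⊔ AddCommGroup.torsion _ :=
  Rank3Row.pSaturated_of_pSatCheckKSel_idx (by rfl) pSatCheckK_11

/-- **GENERATORS under ONE named numeric hypothesis, chunk 11** (20 rows, register J11c
`m ≤ 10`; `m = 1` rows = LEVER S, saturation by exhaustive search): for every listed `(i, m)`, if
`rank3Rows11[i]` is a GRAND row and the index of its listed span is `≤ m` (instrument DATA, two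
implementations agree), then `E(ℚ) = ℤP₁ + ℤP₂ + ℤP₃ + E(ℚ)_tors`.
[cite: CremonaPrickettSiksek2006, Thm 1] [cite: CremonaAlgorithms1997, §3.5] -/
theorem generators11 :
    ∀ e ∈ ([
      (6, 3), (7, 7), (51, 1), (89, 1), (106, 1), (119, 1), (122, 1), (141, 10), (142, 1), (163, 1),
      (177, 3), (207, 1), (214, 2), (237, 1), (264, 4), (265, 2), (281, 1), (328, 1), (338, 5),
      (349, 1)] : List (ℕ × ℕ)),
      ∃ r, rank3Rows11[e.1]? = some r ∧ ∀ (hr : r ∈ rows) (h : r.check = true),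
        (AddSubgroup.closure {r.gen₁ h, r.gen₂ h, r.gen₃ h} ⊔ AddCommGroup.torsion _).index ≤ e.2 →
          AddSubgroup.closure {r.gen₁ h, r.gen₂ h, r.gen₃ h} ⊔ AddCommGroup.torsion _ = ⊤ := by
  intro e he
  obtain ⟨r, hr', H⟩ := cover11 e he
  refine ⟨r, hr', fun hr h hB => ?_⟩
  obtain ⟨hfi, h2, h3, h5, h7⟩ := PSatCensus357.index_coprime_210_of_mem_rows hr h
  haveI := hfi
  refine AddSubgroup.index_eq_one.mp
    (eq_one_of_forall_prime_le_not_dvd AddSubgroup.FiniteIndex.index_ne_zero hB fun p hp hpB => ?_)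
  by_cases h7p : 7 < p
  · exact not_dvd_index_listedSpan hp (H p hp h7p hpB h)
  · exact not_dvd_of_prime_le_seven h2 h3 h5 h7 hp h7p

/-- **Chunk 12, register J11c** (13 rows, two-implementation CPS-bound datum `m ≤ 10`): kernel check
of the selection `(position, m, [])` — every listed row exists in `rank3Rows12` and no prime
`7 < p ≤ m` is left uncertified (there is none). [cite: CremonaPrickettSiksek2006, Thm 1] -/
theorem pSatCheckK_12 :
    rank3PSatCheckKSel rank3Rows12 [
    (93, 1, []), (132, 1, []), (133, 1, []), (136, 1, []), (172, 1, []), (189, 3, []), (218, 2, []),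
    (233, 4, []), (234, 1, []), (251, 1, []), (292, 1, []), (296, 5, []), (330, 5, [])] = true := by
  decide +kernel

set_option maxRecDepth 8000 in
/-- **Chunk 12: cover** — for every listed `(i, m)` the row `rank3Rows12[i]` exists and its listed
span is `p`-saturated for every prime `7 < p ≤ m` (vacuous range; generic soundness of the selection
form). [cite: CremonaAlgorithms1997, §3.5] -/
theorem cover12 :
    ∀ e ∈ ([
      (93, 1), (132, 1), (133, 1), (136, 1), (172, 1), (189, 3), (218, 2), (233, 4), (234, 1),
      (251, 1), (292, 1), (296, 5), (330, 5)] : List (ℕ × ℕ)),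
      ∃ r, rank3Rows12[e.1]? = some r ∧ ∀ p, p.Prime → 7 < p → p ≤ e.2 →
        ∀ h : r.check = true, ∀ a : r.curve.toAffine.Point,
          p • a ∈ AddSubgroup.closure {r.gen₁ h, r.gen₂ h, r.gen₃ h} ⊔ AddCommGroup.torsion _ →
            a ∈ AddSubgroup.closure {r.gen₁ h, r.gen₂ h, r.gen₃ h} ⊔ AddCommGroup.torsion _ :=
  Rank3Row.pSaturated_of_pSatCheckKSel_idx (by rfl) pSatCheckK_12

/-- **GENERATORS under ONE named numeric hypothesis, chunk 12** (13 rows, register J11c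
`m ≤ 10`; `m = 1` rows = LEVER S, saturation by exhaustive search): for every listed `(i, m)`, if
`rank3Rows12[i]` is a GRAND row and the index of its listed span is `≤ m` (instrument DATA, two
implementations agree), then `E(ℚ) = ℤP₁ + ℤP₂ + ℤP₃ + E(ℚ)_tors`.
[cite: CremonaPrickettSiksek2006, Thm 1] [cite: CremonaAlgorithms1997, §3.5] -/
theorem generators12 :
    ∀ e ∈ ([
      (93, 1), (132, 1), (133, 1), (136, 1), (172, 1), (189, 3), (218, 2), (233, 4), (234, 1),
      (251, 1), (292, 1), (296, 5), (330, 5)] : List (ℕ × ℕ)),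
      ∃ r, rank3Rows12[e.1]? = some r ∧ ∀ (hr : r ∈ rows) (h : r.check = true),
        (AddSubgroup.closure {r.gen₁ h, r.gen₂ h, r.gen₃ h} ⊔ AddCommGroup.torsion _).index ≤ e.2 →
          AddSubgroup.closure {r.gen₁ h, r.gen₂ h, r.gen₃ h} ⊔ AddCommGroup.torsion _ = ⊤ := by
  intro e he
  obtain ⟨r, hr', H⟩ := cover12 e he
  refine ⟨r, hr', fun hr h hB => ?_⟩
  obtain ⟨hfi, h2, h3, h5, h7⟩ := PSatCensus357.index_coprime_210_of_mem_rows hr h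
  haveI := hfi
  refine AddSubgroup.index_eq_one.mp
    (eq_one_of_forall_prime_le_not_dvd AddSubgroup.FiniteIndex.index_ne_zero hB fun p hp hpB => ?_)
  by_cases h7p : 7 < p
  · exact not_dvd_index_listedSpan hp (H p hp h7p hpB h)
  · exact not_dvd_of_prime_le_seven h2 h3 h5 h7 hp h7p

/-- **Chunk 13, register J11c** (12 rows, two-implementation CPS-bound datum `m ≤ 10`): kernel check
of the selection `(position, m, [])` — every listed row exists in `rank3Rows13` and no prime
`7 < p ≤ m` is left uncertified (there is none). [cite: CremonaPrickettSiksek2006, Thm 1] -/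
theorem pSatCheckK_13 :
    rank3PSatCheckKSel rank3Rows13 [
    (95, 2, []), (104, 5, []), (112, 1, []), (113, 1, []), (130, 1, []), (170, 1, []), (173, 2, []),
    (197, 1, []), (251, 1, []), (256, 6, []), (285, 1, []), (336, 1, [])] = true := by
  decide +kernel

set_option maxRecDepth 8000 in
/-- **Chunk 13: cover** — for every listed `(i, m)` the row `rank3Rows13[i]` exists and its listed
span is `p`-saturated for every prime `7 < p ≤ m` (vacuous range; generic soundness of the selection
form). [cite: CremonaAlgorithms1997, §3.5] -/
theorem cover13 :
    ∀ e ∈ ([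
      (95, 2), (104, 5), (112, 1), (113, 1), (130, 1), (170, 1), (173, 2), (197, 1), (251, 1),
      (256, 6), (285, 1), (336, 1)] : List (ℕ × ℕ)),
      ∃ r, rank3Rows13[e.1]? = some r ∧ ∀ p, p.Prime → 7 < p → p ≤ e.2 →
        ∀ h : r.check = true, ∀ a : r.curve.toAffine.Point,
          p • a ∈ AddSubgroup.closure {r.gen₁ h, r.gen₂ h, r.gen₃ h} ⊔ AddCommGroup.torsion _ →
            a ∈ AddSubgroup.closure {r.gen₁ h, r.gen₂ h, r.gen₃ h} ⊔ AddCommGroup.torsion _ :=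
  Rank3Row.pSaturated_of_pSatCheckKSel_idx (by rfl) pSatCheckK_13

/-- **GENERATORS under ONE named numeric hypothesis, chunk 13** (12 rows, register J11c
`m ≤ 10`; `m = 1` rows = LEVER S, saturation by exhaustive search): for every listed `(i, m)`, if
`rank3Rows13[i]` is a GRAND row and the index of its listed span is `≤ m` (instrument DATA, two
implementations agree), then `E(ℚ) = ℤP₁ + ℤP₂ + ℤP₃ + E(ℚ)_tors`.
[cite: CremonaPrickettSiksek2006, Thm 1] [cite: CremonaAlgorithms1997, §3.5] -/
theorem generators13 :
    ∀ e ∈ ([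
      (95, 2), (104, 5), (112, 1), (113, 1), (130, 1), (170, 1), (173, 2), (197, 1), (251, 1),
      (256, 6), (285, 1), (336, 1)] : List (ℕ × ℕ)),
      ∃ r, rank3Rows13[e.1]? = some r ∧ ∀ (hr : r ∈ rows) (h : r.check = true),
        (AddSubgroup.closure {r.gen₁ h, r.gen₂ h, r.gen₃ h} ⊔ AddCommGroup.torsion _).index ≤ e.2 →
          AddSubgroup.closure {r.gen₁ h, r.gen₂ h, r.gen₃ h} ⊔ AddCommGroup.torsion _ = ⊤ := by
  intro e he
  obtain ⟨r, hr', H⟩ := cover13 e he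
  refine ⟨r, hr', fun hr h hB => ?_⟩
  obtain ⟨hfi, h2, h3, h5, h7⟩ := PSatCensus357.index_coprime_210_of_mem_rows hr h
  haveI := hfi
  refine AddSubgroup.index_eq_one.mp
    (eq_one_of_forall_prime_le_not_dvd AddSubgroup.FiniteIndex.index_ne_zero hB fun p hp hpB => ?_)
  by_cases h7p : 7 < p
  · exact not_dvd_index_listedSpan hp (H p hp h7p hpB h)
  · exact not_dvd_of_prime_le_seven h2 h3 h5 h7 hp h7p

end PSatCensusS10CPS

end Summit.BirchSwinnertonDyer.BirchSwinnertonDyer.Rank2Observatory
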